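import Mathlib.MeasureTheory.Group.Measure
import Mathlib.Topology.Algebra.Group.Compact
import HarnessLib

/-!
# A soft multiplicity bound for left-invariant measures: `μ(B q Y) ≤ N μ(B Y)` uniformly in `q`

Let `G` be a topological group with a left-invariant Borel measure `μ`, `B` a compact neighbourhood
of `1` and `Q ⊆ G` compact. The measure of a left thickening `B · X` is not controlled by `μ(X)`
in general (a thin long set has a fat thickening), but inserting a bounded element costs only a
bounded factor:

* `exists_measure_mul_singleton_mul_le` — there is `N ∈ ℕ` with `μ(B · q · Y) ≤ N · μ(B · Y)` for
  all `q ∈ Q` and all `Y ⊆ G`. Indeed `B q Y = q (q⁻¹ B q) Y`, the conjugates `q⁻¹ B q`, `q ∈ Q`,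
  lie in a compact set `D`, `D` is covered by `N` left translates `gᵢ B°`, and
  `μ(q gᵢ B° Y) = μ(B° Y) ≤ μ(B Y)` by left invariance.
* `measure_mul_singleton_prod_mul_le`, `measure_mul_singleton_pow_mul_le` — iterating,
  `μ(B · (q₁ ⋯ q_m) · Y) ≤ N^m · μ(B · Y)` for `qᵢ ∈ Q`, in particular for powers `q^m`.

Purpose: in the basic estimate for cusp forms on a Siegel set of `GL_n`
(`Literature.NumberTheory.Automorphic.GLnCuspidalSpectrum.norm_smoothedForm_le_of_isSiegelSetGL`,
Garrett (2018), Thm. 7.3.10; Getz–Hahn (2024), Prop. 9.6.1, (9.22)–(9.23)) the `L²`-mass of a cusp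
form over a region `a · C` of `GL_n(𝔸_K)`, `a` in the Siegel cone, is dominated by
`μ(B' a C) / μ_X(B'° x₀) · ‖f‖²` (`InvariantMeasureDominationExplicit`); writing `a = β^m` with `β`
in a fixed compact set and `m ≍ log (max root of a)` the present bound gives
`μ(B' a C) ≤ N^m μ(B' C)`, a *polynomial* bound in the roots of `a`, which is all the estimate needs
— no computation of Haar measure or of moduli of conjugation is required. Elementary; folklore
(a covering-number argument).
-/

noncomputable section

open MeasureTheory Set Filter
open scoped Topology Pointwise ENNReal

namespace Literature.MeasureTheory.Group

variable {G : Type*} [Group G] [TopologicalSpace G] [IsTopologicalGroup G] [MeasurableSpace G]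
  [BorelSpace G] (μ : Measure G) [μ.IsMulLeftInvariant]

omit [TopologicalSpace G] [IsTopologicalGroup G] [BorelSpace G] in
/-- Left translates do not change a left-invariant measure: `μ({g} · S) = μ(S)`. [folklore] -/
theorem measure_singleton_mul [MeasurableMul G] (g : G) (S : Set G) : μ ({g} * S) = μ S := by
  rw [singleton_mul, image_mul_left, measure_preimage_mul]

omit [TopologicalSpace G] [IsTopologicalGroup G] [MeasurableSpace G] [BorelSpace G] in
/-- `{a} · ({b} · S) = {a b} · S`. [folklore] -/
theorem singleton_mul_singleton_mul (a b : G) (S : Set G) : {a} * ({b} * S) = {a * b} * S := by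
  rw [← mul_assoc, singleton_mul_singleton]

/-- **Soft multiplicity bound.** For a compact neighbourhood `B` of `1` and a compact `Q` there is
`N ∈ ℕ` such that `μ(B · q · Y) ≤ N · μ(B · Y)` for every `q ∈ Q` and every `Y ⊆ G`: the
conjugates `q⁻¹ B q` (`q ∈ Q`) lie in a compact set covered by `N` left translates of the interior
of `B`, and left translation does not change `μ`. [folklore] -/
theorem exists_measure_mul_singleton_mul_le {Q B : Set G} (hQ : IsCompact Q) (hB : IsCompact B)
    (hB1 : B ∈ 𝓝 (1 : G)) :
    ∃ N : ℕ, ∀ q ∈ Q, ∀ Y : Set G, μ (B * ({q} * Y)) ≤ N * μ (B * Y) := by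
  classical
  -- the compact set of conjugates `q⁻¹ b q`
  set D : Set G := (fun p : G × G => p.1⁻¹ * p.2 * p.1) '' Q ×ˢ B with hD
  have hDc : IsCompact D :=
    (hQ.prod hB).image ((continuous_fst.inv.mul continuous_snd).mul continuous_fst)
  -- cover `D` by left translates of the interior of `B`
  have h1 : (1 : G) ∈ interior B := mem_interior_iff_mem_nhds.2 hB1
  have hcover : D ⊆ ⋃ g : G, (fun x => g * x) '' interior B := by
    intro d _
    exact mem_iUnion.2 ⟨d, ⟨1, h1, mul_one d⟩⟩
  have hopen : ∀ g : G, IsOpen ((fun x => g * x) '' interior B) := fun g =>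
    (isOpenMap_mul_left g) _ isOpen_interior
  obtain ⟨t, ht⟩ := hDc.elim_finite_subcover _ hopen hcover
  refine ⟨t.card, fun q hq Y => ?_⟩
  -- `B q Y ⊆ ⋃_{g ∈ t} q g (B° Y)`
  have hsub : B * ({q} * Y) ⊆ ⋃ g ∈ t, {q * g} * (interior B * Y) := by
    rintro _ ⟨b, hb, _, ⟨a, ha, y, hy, rfl⟩, rfl⟩
    have ha' : a = q := mem_singleton_iff.1 ha
    have hd : q⁻¹ * b * q ∈ D := ⟨(q, b), ⟨hq, hb⟩, rfl⟩
    obtain ⟨g, hg, x, hx, hgx⟩ := mem_iUnion₂.1 (ht hd)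
    refine mem_iUnion₂.2 ⟨g, hg, ?_⟩
    refine ⟨q * g, rfl, x * y, ⟨x, hx, y, hy, rfl⟩, ?_⟩
    change q * g * (x * y) = b * (a * y)
    rw [ha']
    have : g * x = q⁻¹ * b * q := hgx
    calc q * g * (x * y) = q * (g * x) * y := by group
      _ = q * (q⁻¹ * b * q) * y := by rw [this]
      _ = b * (q * y) := by group
  haveI : MeasurableMul G := inferInstance
  calc μ (B * ({q} * Y)) ≤ μ (⋃ g ∈ t, {q * g} * (interior B * Y)) := measure_mono hsub
    _ ≤ ∑ g ∈ t, μ ({q * g} * (interior B * Y)) := measure_biUnion_finset_le _ _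
    _ ≤ ∑ _g ∈ t, μ (B * Y) := by
        refine Finset.sum_le_sum fun g _ => ?_
        rw [measure_singleton_mul]
        exact measure_mono (mul_subset_mul_right interior_subset)
    _ = t.card * μ (B * Y) := by rw [Finset.sum_const, nsmul_eq_mul]

omit [TopologicalSpace G] [IsTopologicalGroup G] [BorelSpace G] [μ.IsMulLeftInvariant] in
/-- **Iterated form**: if `μ(B · q · Y) ≤ N · μ(B · Y)` for all `q ∈ Q` and all `Y`, then
`μ(B · (q₁ ⋯ q_m) · Y) ≤ N^m · μ(B · Y)` whenever all `qᵢ ∈ Q`. [folklore] -/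
theorem measure_mul_singleton_prod_mul_le {Q B : Set G} {N : ℕ}
    (hN : ∀ q ∈ Q, ∀ Y : Set G, μ (B * ({q} * Y)) ≤ N * μ (B * Y)) :
    ∀ l : List G, (∀ q ∈ l, q ∈ Q) → ∀ Y : Set G,
      μ (B * ({l.prod} * Y)) ≤ (N : ℝ≥0∞) ^ l.length * μ (B * Y) := by
  intro l
  induction l with
  | nil => intro _ Y; simp
  | cons q l ih =>
    intro hl Y
    rw [List.prod_cons, ← singleton_mul_singleton_mul, List.length_cons, pow_succ']
    calc μ (B * ({q} * ({l.prod} * Y))) ≤ N * μ (B * ({l.prod} * Y)) :=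
          hN q (hl q List.mem_cons_self) _
      _ ≤ N * ((N : ℝ≥0∞) ^ l.length * μ (B * Y)) := by
          gcongr
          exact ih (fun q' hq' => hl q' (List.mem_cons_of_mem q hq')) Y
      _ = N * (N : ℝ≥0∞) ^ l.length * μ (B * Y) := by rw [mul_assoc]

omit [TopologicalSpace G] [IsTopologicalGroup G] [BorelSpace G] [μ.IsMulLeftInvariant] in
/-- **Power form**: if `μ(B · q · Y) ≤ N · μ(B · Y)` for all `q ∈ Q` and all `Y`, then
`μ(B · q^m · Y) ≤ N^m · μ(B · Y)` for `q ∈ Q`. [folklore] -/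
theorem measure_mul_singleton_pow_mul_le {Q B : Set G} {N : ℕ}
    (hN : ∀ q ∈ Q, ∀ Y : Set G, μ (B * ({q} * Y)) ≤ N * μ (B * Y)) {q : G} (hq : q ∈ Q)
    (m : ℕ) (Y : Set G) : μ (B * ({q ^ m} * Y)) ≤ (N : ℝ≥0∞) ^ m * μ (B * Y) := by
  have h := measure_mul_singleton_prod_mul_le μ hN (List.replicate m q)
    (fun q' hq' => by rw [List.eq_of_mem_replicate hq']; exact hq) Y
  rwa [List.prod_replicate, List.length_replicate] at h

end Literature.MeasureTheory.Group
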